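import Summits.Ventures.LatticeQCDFlow.Scaling.FiniteOddsDominationCriterion

/-!
HONEST FRAMING: exact (Metropolis-corrected) sampling algorithms for lattice gauge theory; figures
of merit are autocorrelation/cost numbers at stated couplings and volumes; no continuum-physics
claim.

# FiniteOddsDominationLaw — THE LAW OF ITEM 1 (i) AT EVERY SWAP RATE FROM DOMINATION ALONE: IF FOR EVERY ADJACENT EQUAL-HUB PAIR OF THE LUMPED STAR THE TAGGED TAIL LAWS OF THE
# COPY HOLDING THE MORE PERSISTENT EXTRA PARTICLE DOMINATE (ON EVERY ORDINARY CONTENT FROM THE HUB, AND AT THE HUB CONTENT FROM ★), THEN WITH THE OPTIMAL END-HUB COUPLINGS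
# `d(n) ≤ ((K+1)(c+2K+2) + 2(K+1)(c+2K+6))·(1−ρ)ⁿ`, `ρ = 2σ·pE_{μ_0}[Wθ]/(c+2K+2)`, ANY `c ≥ 2K+2` (lean-2 GEN-37, ours)

Venture-side (OURS).  Cell `lqcd-flow` (pub-lqcd), unit `pub-lqcd-lean-2-g37`, 2026-08-30.  Chapter W (item 1 (i) at finite swap odds), file 23 = the bookkeeping assembly of files 19
(`finiteOdds_adjacent_worstTvDist_le'`) and 22 (`adjacent_optimal_monotone`, `adjacent_hpers_of_domination`): the end-hub tail laws of every pair are coupled by the LPW-4.7 optimal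
coupling; for each adjacent equal-hub pair the user supplies the tagged chains and tail laws of files 14–21 (hypothesis-equations) for the orientation in which the first copy holds the
more persistent extra particle, together with the two DOMINATION statements (MEMO-gen37's Conjecture M; its start-content instance is file 20); the other orientation follows by the
symmetry of the criterion (`cdist_coupling_transpose`, the optimal coupling of `(ν,μ)` is the transpose of that of `(μ,ν)`).  Hypothesis-equations, no definitions.

## What is proved

* `optimalCoupling_transpose`, `survivor_sum`, `cdist_coupling_transpose`, `tail_fixedPoint`, `tail_legal`, **`finiteOdds_domination_worstTvDist_le`**.

Reading (no numerics implied): with `c = 2K+2` this is the law conjectured in MEMO-gen36 (`(K/(σp))·log(K/ε)` cycles at every swap rate), conditional on domination only.  NOT CLAIMED: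
domination.  Literature grade (cell rule): OWN on the tree's LPW files; nothing cited as a fact; no new bib keys.
-/

open Finset Matrix
open Literature.Probability.MarkovChains

namespace Summit.Ventures.LatticeQCDFlow.Scaling

section Symm
variable {S : Type*} [Fintype S] [DecidableEq S]

/-- The optimal coupling of `(ν, μ)` is the transpose of that of `(μ, ν)`. [ours] -/
theorem optimalCoupling_transpose (μ ν : S → ℝ) (a b : S) : optimalCoupling ν μ b a = optimalCoupling μ ν a b := by
  unfold optimalCoupling
  rw [tvDist_comm ν μ, min_comm (ν b) (μ b), min_comm (ν a) (μ a)]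
  by_cases h : a = b
  · subst h; simp [mul_comm]
  · rw [if_neg (Ne.symm h), if_neg h]; ring

/-- The survivors of a legal deletion number `K`. [ours] -/
theorem survivor_sum {K : ℕ} {N : S → ℕ} (hN : ∑ v, N v = K + 1) {a : S} (ha : N a ≠ 0) : ∑ v, (N - Pi.single a 1 : S → ℕ) v = K := by
  have e := urnChain_survivor N ha
  have h : ∑ v, N v = ∑ v, (N - Pi.single a 1 : S → ℕ) v + 1 := by
    conv_lhs => rw [e]
    simp only [Pi.add_apply]; rw [sum_add_distrib, Finset.sum_pi_single']; simp
  omega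

/-- **Transposing a legally supported coupling leaves the expected survivor distance unchanged** (the distance is symmetric on equal totals). [ours] -/
theorem cdist_coupling_transpose {Δ : (S → ℕ) → (S → ℕ) → ℕ} (hΔ : ∀ N N', Δ N N' = ∑ v, (N v - N' v)) {K : ℕ} {NX NY : S → ℕ}
    (hX : ∑ v, NX v = K + 1) (hY : ∑ v, NY v = K + 1) {qt : S → S → ℝ} (hleg : ∀ a b, qt a b ≠ 0 → NX a ≠ 0 ∧ NY b ≠ 0) :
    ∑ a, ∑ b, qt b a * (Δ (NY - Pi.single a 1 : S → ℕ) (NX - Pi.single b 1 : S → ℕ) : ℝ) = ∑ a, ∑ b, qt a b * (Δ (NX - Pi.single a 1 : S → ℕ) (NY - Pi.single b 1 : S → ℕ) : ℝ) := by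
  rw [sum_comm]
  refine sum_congr rfl fun a _ => sum_congr rfl fun b _ => ?_
  by_cases h : qt a b = 0
  · rw [h]; simp
  · obtain ⟨ha, hb⟩ := hleg a b h
    rw [cdist_symm_of_sum_eq hΔ (by rw [survivor_sum hY hb, survivor_sum hX ha])]

end Symm

section DomLaw
variable {X : Type*} [Fintype X] [DecidableEq X] {S : Type*} [Fintype S] [DecidableEq S]
variable {hub : X → S} {comp : X → S → ℕ} {K : ℕ} {μ0 W θ : S → ℝ} {p σ ρ C c : ℝ} {acc : S → S → ℝ} {Kh : (S → ℕ) → S → S → ℝ}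
variable {u ut : X → S → ℝ} {qt q : X → X → S → S → ℝ}
variable {P : X → X → ℝ} {Q : Matrix (X × X) (X × X) ℝ} {Δ : (S → ℕ) → (S → ℕ) → ℕ} {F Ψ : X × X → ℝ}
variable {NCf : X → X → S → ℕ} {af bf : X → X → S} {PXf PYf : X → X → Option S → Option S → ℝ} {xtf ytf xsf ysf : X → X → Option S → ℝ}

/-- The tail law solves its own fixed-point equation: `ũ = (1−σ)K(z,·) + σũK`. [ours] -/
theorem tail_fixedPoint {Kz : S → S → ℝ} {z : S} {uz utz : S → ℝ} (hu : ∀ v, uz v = (1 - σ) * (if v = z then (1 : ℝ) else 0) + σ * ∑ h, uz h * Kz h v)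
    (hut : ∀ v, utz v = ∑ h, uz h * Kz h v) (w : S) : utz w = (1 - σ) * Kz z w + σ * ∑ h, utz h * Kz h w := by
  have h := geomResolvent_tail_eq hu hut w
  rw [h]; congr 2
  simp_rw [ite_mul, one_mul, zero_mul]; rw [Finset.sum_ite_eq' univ z]; simp

omit [Fintype X] [DecidableEq X] [DecidableEq S] in
/-- The tail law is legal: `ũ_x(w) ≠ 0 ⇒ comp x (w) ≠ 0`. [ours] -/
theorem tail_legal (hKoff : ∀ N h v, h ≠ v → Kh N h v = if N h = 0 then 0 else (N v : ℝ) / K * acc h v)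
    (hlegal : ∀ x a, u x a ≠ 0 → comp x a ≠ 0) (hut : ∀ x v, ut x v = ∑ h, u x h * Kh (comp x) h v) (x : X) (w : S) (hw : ut x w ≠ 0) : comp x w ≠ 0 := by
  intro hcw
  apply hw
  rw [hut]
  refine sum_eq_zero fun h _ => ?_
  by_cases huh : u x h = 0
  · rw [huh, zero_mul]
  · have hch := hlegal x h huh
    have hhw : h ≠ w := fun e => hch (e ▸ hcw)
    rw [starHub_closed (hKoff (comp x)) hch hcw, mul_zero]

/-- **THE LAW OF ITEM 1 (i) AT EVERY SWAP RATE FROM DOMINATION ON ADJACENT PAIRS.**  Setting of chapter W file 7 with end-hub laws = the resolvents, tail laws coupled by the LPW-4.7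
optimal coupling, potential constant `c ≥ 2K+2`, rate `ρ ≥ 0` with `ρ(c+2K+2) ≤ 2σpE_{μ_0}[Wθ]` and `ρ ≤ ½`.  For every adjacent equal-hub ordered pair `(x,y)` ORIENTED so that
`W(b) ≤ W(a)` (`comp x = N_C + δ_a`, `comp y = N_C + δ_b`) the tagged hub chains and their tail laws from the hub and from ★ are given (hypothesis-equations of files 14–21) together
with the DOMINATION statements `ỹ(w) ≤ x̃(w)` (all ordinary `w`) and `ỹ_★(z) ≤ x̃_★(z)`; every adjacent pair is oriented one way or the other.  Then
`d(n) ≤ ((K+1)(c+2K+2) + 2(K+1)(c+2K+6))·(1−ρ)ⁿ`. [ours] -/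
theorem finiteOdds_domination_worstTvDist_le [Nonempty X] (hinj : ∀ x x', hub x = hub x' → comp x = comp x' → x = x') (hsum : ∀ x, ∑ v, comp x v = K + 1)
    (hsurj : ∀ (z : S) (N : S → ℕ), ∑ v, N v = K + 1 → N z ≠ 0 → ∃ x, hub x = z ∧ comp x = N) (hhub : ∀ x, comp x (hub x) ≠ 0) (hK : 1 ≤ K)
    (hW : ∀ v, 0 < W v) (hp0 : 0 ≤ p) (hp : ∀ v, p * W v ≤ 1) (hθ : ∀ v, θ v = 1 / (1 + p * W v)) (hacc : ∀ h v, acc h v = min 1 (W h / W v))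
    (hμ0 : ∀ v, 0 ≤ μ0 v) (hμ1 : ∑ v, μ0 v = 1) (hc : 2 * (K : ℝ) + 2 ≤ c) (hσ0 : 0 ≤ σ) (hσ1 : σ < 1) (hρ0 : 0 ≤ ρ) (hρ : ρ ≤ 1 / 2)
    (hρc : ρ * (c + 2 * K + 2) ≤ 2 * σ * (p * ∑ v, μ0 v * (W v * θ v)))
    (hKoff : ∀ N h v, h ≠ v → Kh N h v = if N h = 0 then 0 else (N v : ℝ) / K * acc h v) (hKdiag : ∀ N h, Kh N h h = 1 - ∑ v ∈ univ.erase h, Kh N h v)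
    (hu : ∀ x v, u x v = (1 - σ) * (if v = hub x then (1 : ℝ) else 0) + σ * ∑ h, u x h * Kh (comp x) h v)
    (hut : ∀ x v, ut x v = ∑ h, u x h * Kh (comp x) h v)
    (hqt : ∀ x y a b, qt x y a b = optimalCoupling (ut x) (ut y) a b)
    (hq : ∀ x y a b, q x y a b = (1 - σ) * ((if a = hub x then (1 : ℝ) else 0) * (if b = hub y then (1 : ℝ) else 0)) + σ * qt x y a b)
    (hΔ : ∀ N N', Δ N N' = ∑ v, (N v - N' v))
    (hP : ∀ x x', P x x' = ∑ a, u x a * (μ0 (hub x') * (if comp x' + Pi.single a 1 = comp x + Pi.single (hub x') 1 then (1 : ℝ) else 0)))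
    (hQ : ∀ x y x' y', Q (x, y) (x', y') = ∑ a, ∑ b, q x y a b * (μ0 (hub x')
      * (if comp x' + Pi.single a 1 = comp x + Pi.single (hub x') 1 then (1 : ℝ) else 0))
      * ((if hub y' = hub x' then (1 : ℝ) else 0) * (if comp y' + Pi.single b 1 = comp y + Pi.single (hub y') 1 then (1 : ℝ) else 0)))
    (hF : ∀ x y, F (x, y) = c + (-(1 - σ) * θ (hub x)) + (-(1 - σ) * θ (hub y)) + ∑ v, θ v * ((comp x v : ℝ) + (comp y v : ℝ)))
    (hC : C = 2 * ((K + 1) * (c + 2 * K + 6)))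
    (hΨ : ∀ x y, Ψ (x, y) = (Δ (comp x) (comp y) : ℝ) * F (x, y) + C * (if hub x = hub y then (0 : ℝ) else 1))
    -- the tagged data of every ORIENTED adjacent pair
    (horient : ∀ x y, hub x = hub y → Δ (comp x) (comp y) = 1 → W (bf x y) ≤ W (af x y) ∨ W (bf y x) ≤ W (af y x))
    (hcx : ∀ x y, hub x = hub y → Δ (comp x) (comp y) = 1 → W (bf x y) ≤ W (af x y) → comp x = NCf x y + Pi.single (af x y) 1)
    (hcy : ∀ x y, hub x = hub y → Δ (comp x) (comp y) = 1 → W (bf x y) ≤ W (af x y) → comp y = NCf x y + Pi.single (bf x y) 1)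
    (hPXoff : ∀ x y, hub x = hub y → Δ (comp x) (comp y) = 1 → W (bf x y) ≤ W (af x y) →
      ∀ h v, h ≠ v → PXf x y (some h) (some v) = if NCf x y h = 0 then 0 else (NCf x y v : ℝ) / K * acc h v)
    (hPXin : ∀ x y, hub x = hub y → Δ (comp x) (comp y) = 1 → W (bf x y) ≤ W (af x y) →
      ∀ h, PXf x y (some h) none = if NCf x y h = 0 then 0 else acc h (af x y) / K)
    (hPXdiag : ∀ x y, hub x = hub y → Δ (comp x) (comp y) = 1 → W (bf x y) ≤ W (af x y) →
      ∀ h, PXf x y (some h) (some h) = 1 - (∑ v ∈ univ.erase h, PXf x y (some h) (some v) + PXf x y (some h) none))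
    (hPXout : ∀ x y, hub x = hub y → Δ (comp x) (comp y) = 1 → W (bf x y) ≤ W (af x y) → ∀ v, PXf x y none (some v) = (NCf x y v : ℝ) / K * acc (af x y) v)
    (hPXstay : ∀ x y, hub x = hub y → Δ (comp x) (comp y) = 1 → W (bf x y) ≤ W (af x y) → PXf x y none none = 1 - ∑ v, PXf x y none (some v))
    (hPYoff : ∀ x y, hub x = hub y → Δ (comp x) (comp y) = 1 → W (bf x y) ≤ W (af x y) →
      ∀ h v, h ≠ v → PYf x y (some h) (some v) = if NCf x y h = 0 then 0 else (NCf x y v : ℝ) / K * acc h v)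
    (hPYin : ∀ x y, hub x = hub y → Δ (comp x) (comp y) = 1 → W (bf x y) ≤ W (af x y) →
      ∀ h, PYf x y (some h) none = if NCf x y h = 0 then 0 else acc h (bf x y) / K)
    (hPYdiag : ∀ x y, hub x = hub y → Δ (comp x) (comp y) = 1 → W (bf x y) ≤ W (af x y) →
      ∀ h, PYf x y (some h) (some h) = 1 - (∑ v ∈ univ.erase h, PYf x y (some h) (some v) + PYf x y (some h) none))
    (hPYout : ∀ x y, hub x = hub y → Δ (comp x) (comp y) = 1 → W (bf x y) ≤ W (af x y) → ∀ v, PYf x y none (some v) = (NCf x y v : ℝ) / K * acc (bf x y) v)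
    (hPYstay : ∀ x y, hub x = hub y → Δ (comp x) (comp y) = 1 → W (bf x y) ≤ W (af x y) → PYf x y none none = 1 - ∑ v, PYf x y none (some v))
    (hxtf : ∀ x y, hub x = hub y → Δ (comp x) (comp y) = 1 → W (bf x y) ≤ W (af x y) →
      ∀ t, xtf x y t = (1 - σ) * PXf x y (some (hub x)) t + σ * ∑ t', xtf x y t' * PXf x y t' t)
    (hytf : ∀ x y, hub x = hub y → Δ (comp x) (comp y) = 1 → W (bf x y) ≤ W (af x y) →
      ∀ t, ytf x y t = (1 - σ) * PYf x y (some (hub x)) t + σ * ∑ t', ytf x y t' * PYf x y t' t)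
    (hxsf : ∀ x y, hub x = hub y → Δ (comp x) (comp y) = 1 → W (bf x y) ≤ W (af x y) →
      ∀ t, xsf x y t = (1 - σ) * PXf x y none t + σ * ∑ t', xsf x y t' * PXf x y t' t)
    (hysf : ∀ x y, hub x = hub y → Δ (comp x) (comp y) = 1 → W (bf x y) ≤ W (af x y) →
      ∀ t, ysf x y t = (1 - σ) * PYf x y none t + σ * ∑ t', ysf x y t' * PYf x y t' t)
    -- DOMINATION (Conjecture M of MEMO-gen37), on oriented adjacent pairs
    (hdom : ∀ x y, hub x = hub y → Δ (comp x) (comp y) = 1 → W (bf x y) ≤ W (af x y) → ∀ w, ytf x y (some w) ≤ xtf x y (some w))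
    (hDstar : ∀ x y, hub x = hub y → Δ (comp x) (comp y) = 1 → W (bf x y) ≤ W (af x y) → ysf x y (some (hub x)) ≤ xsf x y (some (hub x)))
    {π : X → ℝ} (hπ : IsStationary π P) (hπ0 : ∀ x, 0 ≤ π x) (hπ1 : ∑ x, π x = 1) (n : ℕ) :
    worstTvDist P π n ≤ ((K + 1) * (c + 2 * K + 2) + 2 * ((K + 1) * (c + 2 * K + 6))) * (1 - ρ) ^ n := by
  classical
  -- end-hub and tail laws
  have hu0 : ∀ x a, 0 ≤ u x a := finiteOdds_endHub_nonneg hW hacc hKoff hKdiag hK hsum hσ0 hσ1 hu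
  have hlegal : ∀ x a, u x a ≠ 0 → comp x a ≠ 0 := finiteOdds_endHub_legal hW hacc hKoff hKdiag hK hsum hhub hσ0 hσ1 hu
  have hut1 : ∀ x, ∑ v, ut x v = 1 := finiteOdds_tail_sum hKdiag hσ1 hu hut
  have hKh0 : ∀ x, ∀ a b, 0 ≤ Kh (comp x) a b := fun x => starHub_nonneg hW hacc (hKoff (comp x)) (hKdiag (comp x)) hK (hsum x)
  have hut0 : ∀ x v, 0 ≤ ut x v := fun x v => geomResolvent_tail_nonneg (hKh0 x) (hu0 x) (hut x) v
  have hutEq : ∀ x w, ut x w = (1 - σ) * Kh (comp x) (hub x) w + σ * ∑ h, ut x h * Kh (comp x) h w := fun x => tail_fixedPoint (hu x) (hut x)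
  have hlegT : ∀ x w, ut x w ≠ 0 → comp x w ≠ 0 := tail_legal hKoff hlegal hut
  have hqfun : ∀ x y, qt x y = optimalCoupling (ut x) (ut y) := fun x y => funext fun a => funext fun b => hqt x y a b
  have hqtc : ∀ x y, IsCoupling (ut x) (ut y) (qt x y) := fun x y => by
    rw [hqfun]; exact optimalCoupling_isCoupling (hut0 x) (hut0 y) (hut1 x) (hut1 y)
  have hc1 : 1 ≤ c := by have : (0 : ℝ) ≤ K := Nat.cast_nonneg _; linarith
  -- the two per-pair facts for ORIENTED adjacent pairs (file 22)
  have horientedX : ∀ x y, hub x = hub y → Δ (comp x) (comp y) = 1 → W (bf x y) ≤ W (af x y) →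
      (∀ a' b', qt x y a' b' ≠ 0 → Δ (comp x - Pi.single a' 1) (comp y - Pi.single b' 1) ≤ Δ (comp x) (comp y)) ∧
      ρ * (Δ (comp x) (comp y) : ℝ) * F (x, y)
        ≤ σ * (((Δ (comp x) (comp y) : ℝ) - ∑ a', ∑ b', qt x y a' b' * (Δ (comp x - Pi.single a' 1) (comp y - Pi.single b' 1) : ℝ))
              * (F (x, y) + (2 * (1 - σ) * θ (hub x) + 2 * σ * ∑ v, μ0 v * θ v) - 2)
            + p * (Δ (comp x) (comp y) : ℝ) * (2 * ∑ v, μ0 v * (W v * θ v) - ∑ a', ut x a' * (W a' * θ a') - ∑ b', ut y b' * (W b' * θ b'))) := by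
    intro x y hxy h1 hor
    -- unpack the tagged data
    have ecx := hcx x y hxy h1 hor
    have ecy := hcy x y hxy h1 hor
    have hab : af x y ≠ bf x y := by
      intro e
      have : comp x = comp y := by rw [ecx, ecy, e]
      have h0 : Δ (comp x) (comp y) = 0 := by rw [this]; exact cdist_self hΔ _
      omega
    have hNC : ∑ v, NCf x y v = K := by
      have h := hsum x; rw [ecx] at h; simp only [Pi.add_apply] at h; rw [sum_add_distrib, Finset.sum_pi_single'] at h; simp at h; omega
    have hz : NCf x y (hub x) ≠ 0 := by
      by_cases hza : hub x = af x y
      · have h := hhub y; rw [ecy, ← hxy] at h; simp only [Pi.add_apply, Pi.single_apply] at h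
        rw [if_neg (fun e => hab (hza.symm.trans e))] at h; simpa using h
      · have h := hhub x; rw [ecx] at h; simp only [Pi.add_apply, Pi.single_apply, if_neg hza, add_zero] at h; exact h
    -- content chains in file 22's shape
    have hKXoff : ∀ h v, h ≠ v → Kh (comp x) h v = if comp x h = 0 then 0 else (comp x v : ℝ) / K * acc h v := fun h v hhv => hKoff (comp x) h v hhv
    have hKYoff : ∀ h v, h ≠ v → Kh (comp y) h v = if comp y h = 0 then 0 else (comp y v : ℝ) / K * acc h v := fun h v hhv => hKoff (comp y) h v hhv
    have hutY' : ∀ w, ut y w = (1 - σ) * Kh (comp y) (hub x) w + σ * ∑ h, ut y h * Kh (comp y) h w := by rw [hxy]; exact hutEq y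
    refine ⟨fun a' b' hne => ?_, ?_⟩
    · rw [hqt] at hne
      exact adjacent_optimal_monotone hΔ hab ecx ecy
        (lump_tail hW hacc ecx (hPXoff x y hxy h1 hor) (hPXin x y hxy h1 hor) (hPXdiag x y hxy h1 hor) (hPXout x y hxy h1 hor) (hPXstay x y hxy h1 hor)
          hKXoff (hKdiag (comp x)) hK hNC hσ0 hσ1 hz (hxtf x y hxy h1 hor) (hutEq x))
        (lump_tail hW hacc ecy (hPYoff x y hxy h1 hor) (hPYin x y hxy h1 hor) (hPYdiag x y hxy h1 hor) (hPYout x y hxy h1 hor) (hPYstay x y hxy h1 hor)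
          hKYoff (hKdiag (comp y)) hK hNC hσ0 hσ1 hz (hytf x y hxy h1 hor) hutY')
        (by
          have hP0 := tagged_nonneg hW hacc (hPXoff x y hxy h1 hor) (hPXin x y hxy h1 hor) (hPXdiag x y hxy h1 hor) (hPXout x y hxy h1 hor) (hPXstay x y hxy h1 hor) hK hNC
          have hP1 := tagged_rowsum (P := PXf x y) (hPXdiag x y hxy h1 hor) (hPXstay x y hxy h1 hor)
          exact geomResolvent_nonneg hP0 hP1 hσ0 hσ1 (ν := fun t => PXf x y (some (hub x)) t) (fun t => hP0 _ _) (hxtf x y hxy h1 hor) none)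
        (hdom x y hxy h1 hor) (hlegT x) (hlegT y) (hut0 x) (hut0 y) a' b' hne
    · have h := adjacent_hpers_of_domination (μ0 := μ0) (c := c) hΔ hW hp0 hp hθ hacc hK hNC hab hor ecx ecy hz
        (hPXoff x y hxy h1 hor) (hPXin x y hxy h1 hor) (hPXdiag x y hxy h1 hor) (hPXout x y hxy h1 hor) (hPXstay x y hxy h1 hor)
        (hPYoff x y hxy h1 hor) (hPYin x y hxy h1 hor) (hPYdiag x y hxy h1 hor) (hPYout x y hxy h1 hor) (hPYstay x y hxy h1 hor)
        hKXoff (hKdiag (comp x)) hKYoff (hKdiag (comp y)) hσ0 hσ1 (hxtf x y hxy h1 hor) (hytf x y hxy h1 hor) (hxsf x y hxy h1 hor) (hysf x y hxy h1 hor)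
        (hutEq x) hutY' (hut0 x) (hut0 y) (hut1 x) (hut1 y) (hlegT x) (hlegT y) (hdom x y hxy h1 hor) (hDstar x y hxy h1 hor)
        (Φ := F (x, y)) (ρ := ρ) (by rw [hF, hxy]) hc hρ0 hρc hμ0
      simp_rw [hqt x y]
      exact h
  -- symmetry for the other orientation
  have hFsymm : ∀ x y, F (y, x) = F (x, y) := fun x y => by rw [hF, hF]; rw [show (∑ v, θ v * ((comp y v : ℝ) + (comp x v : ℝ))) = ∑ v, θ v * ((comp x v : ℝ) + (comp y v : ℝ)) from sum_congr rfl fun v _ => by ring]; ring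
  have hΔsymm : ∀ x y, Δ (comp y) (comp x) = Δ (comp x) (comp y) := fun x y => cdist_symm_of_sum_eq hΔ (by rw [hsum, hsum])
  have hqsymm : ∀ x y a' b', qt y x b' a' = qt x y a' b' := fun x y a' b' => by rw [hqt, hqt, optimalCoupling_transpose]
  have hpair : ∀ x y, hub x = hub y → Δ (comp x) (comp y) = 1 →
      (∀ a' b', qt x y a' b' ≠ 0 → Δ (comp x - Pi.single a' 1) (comp y - Pi.single b' 1) ≤ Δ (comp x) (comp y)) ∧
      ρ * (Δ (comp x) (comp y) : ℝ) * F (x, y)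
        ≤ σ * (((Δ (comp x) (comp y) : ℝ) - ∑ a', ∑ b', qt x y a' b' * (Δ (comp x - Pi.single a' 1) (comp y - Pi.single b' 1) : ℝ))
              * (F (x, y) + (2 * (1 - σ) * θ (hub x) + 2 * σ * ∑ v, μ0 v * θ v) - 2)
            + p * (Δ (comp x) (comp y) : ℝ) * (2 * ∑ v, μ0 v * (W v * θ v) - ∑ a', ut x a' * (W a' * θ a') - ∑ b', ut y b' * (W b' * θ b'))) := by
    intro x y hxy h1
    rcases horient x y hxy h1 with hor | hor
    · exact horientedX x y hxy h1 hor
    · -- use the pair `(y, x)` and transpose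
      have h1' : Δ (comp y) (comp x) = 1 := by rw [hΔsymm]; exact h1
      obtain ⟨hm, hp'⟩ := horientedX y x hxy.symm h1' hor
      have hlegq : ∀ a' b', qt y x a' b' ≠ 0 → comp y a' ≠ 0 ∧ comp x b' ≠ 0 := by
        intro a' b' hne
        have hc' := hqtc y x
        constructor
        · intro h0; apply hne
          have := hc'.2.1 a'; rw [show ut y a' = 0 from by by_contra hh; exact hlegT y a' hh h0] at this
          exact (sum_eq_zero_iff_of_nonneg fun b _ => hc'.1 a' b).mp this b' (mem_univ _)
        · intro h0; apply hne
          have := hc'.2.2 b'; rw [show ut x b' = 0 from by by_contra hh; exact hlegT x b' hh h0] at this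
          exact (sum_eq_zero_iff_of_nonneg fun a _ => hc'.1 a b').mp this a' (mem_univ _)
      have htr := cdist_coupling_transpose hΔ (hsum y) (hsum x) (qt := qt y x) hlegq
      refine ⟨fun a' b' hne => ?_, ?_⟩
      · have hne' : qt y x b' a' ≠ 0 := by rw [hqsymm]; exact hne
        have := hm b' a' hne'
        obtain ⟨hb, ha⟩ := hlegq b' a' hne'
        rw [cdist_symm_of_sum_eq hΔ (by rw [survivor_sum (hsum y) hb, survivor_sum (hsum x) ha]), hΔsymm] at this
        exact this
      · -- rewrite every term of `hp'` into the `(x,y)` form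
        have e1 : ∑ a', ∑ b', qt y x a' b' * (Δ (comp y - Pi.single a' 1) (comp x - Pi.single b' 1) : ℝ)
            = ∑ a', ∑ b', qt x y a' b' * (Δ (comp x - Pi.single a' 1) (comp y - Pi.single b' 1) : ℝ) := by
          rw [← htr]; exact sum_congr rfl fun a' _ => sum_congr rfl fun b' _ => by rw [hqsymm]
        rw [hΔsymm, hFsymm, e1, ← hxy] at hp'
        have e2 : ∑ a', ut y a' * (W a' * θ a') + ∑ b', ut x b' * (W b' * θ b') = ∑ a', ut x a' * (W a' * θ a') + ∑ b', ut y b' * (W b' * θ b') := add_comm _ _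
        linarith [hp', e2]
  exact finiteOdds_adjacent_worstTvDist_le' hinj hsum hsurj hhub hK hW hp0 hp hθ hacc hμ0 hμ1 hc1 hσ0 hσ1 hρ0 hρ hKoff hKdiag hu hut hqtc hq hΔ
    (fun x y hxy h1 => (hpair x y hxy h1).1) hP hQ hF hC hΨ (fun x y hxy h1 => (hpair x y hxy h1).2) hπ hπ0 hπ1 n

end DomLaw

end Summit.Ventures.LatticeQCDFlow.Scaling
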